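import Mathlib
import HarnessLib

/-!
# Route `KimAtThreeKolyvagin` (rung W2), crux `DeepLowerAtThreeOffKatoStratum` (item 19679, §L child of
# `DeepLowerAtThree` 19075): «Tamagawa divisibility of Kurihara numbers» via LEVEL LOWERING — part 1/3,
# the algebra of partial Kurihara sums (periodicity, twisted sums, the CRT fibre and the Hecke relation)

Cell `bsd-addord`, seat `bsd-addord-w2-c2` (gen 4, OWNER of item `stmt-BirchSwinnertonDyer-19679`). The
off-Kato-stratum LOWER crux at a `BSD(E,3)`-known tower row of analytic rank `0` IS «TamDiv»: every Kurihara
number `δ̃_n` at (deep) cyclic levels is divisible by `3^{v₃(∏ c_ℓ)}` (w2-c2 g2 `KimAtThreeDeepLowerSmallDefect` /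
`…NonAdditiveRows`, acc2 `KimAtThreeDeepLowerOffStratumSockets`; Kim 2022 Conj. 1.10 `≥` half). In print this
is reached only through Kato's Kolyvagin system and the (untyped at `p = 3`, good reduction) Kato–Kurihara
dictionary (Büyükboduk 2009, Kim 2022 Rem. 6.2). THIS THREE-FILE SET gives a DIRECT road on the analytic side:

* (this file, pure algebra over any commutative ring `R`) for a `1`-periodic symbol `φ : ℚ → R` satisfying the
  Hecke relation `2 φ(x) = ∑_{j<ℓ} φ((x+j)/ℓ) + φ(ℓx)` (eigenvalue `a_ℓ ≡ ℓ + 1 ≡ 2` at a Kolyvagin prime),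
  and `ℓ`-periodic additive characters `χ_ℓ : ℕ → R` (discrete logarithms): the twisted-sum expansion
  `∑_c φ(c̃/N) ∏_{ℓ∈T} χ_ℓ((uc)~) = ∑_{U⊆T} (∏_{T∖U} χ_ℓ(ũ)) S_U(N)` of the partial Kurihara sums
  `S_U(N) = ∑_{c ∈ (ℤ/N)ˣ} φ(c̃/N) ∏_{ℓ∈U} χ_ℓ(c̃)`, and the one-prime fibre computation through CRT:
  over a class `b mod N` the classes mod `Nℓ` are `B + N j` (`j < ℓ`), `∑_j φ((B + Nj)/(Nℓ)) = 2φ(B/N) − φ(ℓB/N)`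
  (Hecke), and the single class divisible by `ℓ` contributes `φ((ℓ⁻¹b)~/N)`;
* (part 2, `…LevelLoweringSums`) the recursion `S_T(Nℓ) = 2S_T(N) − (two twisted sums)` and, by induction on the
  level, the VANISHING OF ALL PROPER PARTIAL SUMS `S_T(n)`, `T ⊊ primes(n)` (the lower Taylor coefficients of
  the Mazur–Tate element, Ota 2018 Prop. 2.3 (1) / Kim 2022 §3.5), whence the Kurihara sums of a
  `q`-STABILISED symbol `x ↦ φ(x) − φ(qx)` vanish identically;
* (part 3, `…TamagawaLevelLowering`) the bridge to the tree's `kuriharaNumber` / `∂`-invariants: a stabilised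
  level-lowering congruence `[x]⁺_f ≡ u·(φ(x) − φ(qx)) (mod 3^m)` — Ribet 1990 level lowering at a Tamagawa-`3`
  prime `q` read on integral modular symbols (mod-`3` multiplicity one) for `m = 1` — forces EVERY Kurihara
  number of `f` to vanish mod `3^m`, so `∂^{(i)}(δ̃) ≥ m` for all `i` and TamDiv holds at exponent `m`; the
  by-name rows of crux 19679 / 19075 with `v₃(∏ c_ℓ) ≤ m` follow. This is the mechanism behind Kim 2025 §8.1.2
  ("20787.e1, `c₄₁ = 3`: `δ̃_n` vanishes mod 3 for every `n ∈ 𝒩₁`").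

HONEST FRAMING. Theorems only, no definition, no named fact, no `sorry`; parts 1–2 are unconditional finite
algebra; the level-lowering congruence of part 3 is a DISPLAYED hypothesis (never a fact here); crux 19679
stays OPEN; BSD is not proved by any of this.

References: K. Ota, Amer. J. Math. 140 (2018), Prop. 2.3 (1), Prop. 3.3, §5.1 [Ota2018]; M. Kurihara,
Iwasawa Theory 2012 (2014), §1.1 displays (1)–(2) [Kurihara2014]; B. Mazur, J. Tate, J. Teitelbaum, Invent.
Math. 84 (1986), §I.4 (4.2) [MazurTateTeitelbaum1986Invent]; C.-H. Kim, Amer. J. Math. 148 (2026) =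
arXiv:2203.12159, §1.5.1, Conj. 1.10, §3.5 [Kim2022StructureSelmer]; C.-H. Kim, arXiv:2505.09121, §8.1.2
[Kim2025RefinedTNC]; K. Ribet, Invent. Math. 100 (1990), Thm. 1.1 [Ribet1990].
-/

set_option autoImplicit false
-- the Theorems namespace of a single-conjunct summit repeats the summit name by design (D-0017)
set_option linter.dupNamespace false

noncomputable section

open scoped BigOperators Classical

namespace Summit.BirchSwinnertonDyer.BirchSwinnertonDyer.Theorems.KimAtThreeDeepLowerLevelLoweringFibers

section Abstract

variable {R : Type*} {φ : ℚ → R} {χ : ℕ → ℕ → R}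

/-! ### §1.1 Periodicity bookkeeping for the symbol `φ : ℚ → R` and the logarithms `χ_ℓ : ℕ → R` -/

/-- `1`-periodicity gives `ℤ`-periodicity. [folklore] -/
theorem apply_add_intCast (hper : ∀ x, φ (x + 1) = φ x) (x : ℚ) (k : ℤ) : φ (x + k) = φ x := by
  induction k using Int.induction_on with
  | zero => simp
  | succ i ih =>
    rw [Int.cast_add, Int.cast_one, ← add_assoc, hper, ih]
  | pred i ih =>
    have h := hper (x + ((-(i : ℤ) - 1 : ℤ) : ℚ))
    rw [show x + ((-(i : ℤ) - 1 : ℤ) : ℚ) + 1 = x + ((-(i : ℤ) : ℤ) : ℚ) by push_cast; ring] at h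
    rw [← h]
    exact ih

/-- Two integers with the same residue mod `n` give the same value `φ(k/n)`. [folklore] -/
theorem apply_div_eq_of_intCast_eq (hper : ∀ x, φ (x + 1) = φ x) {n : ℕ} [NeZero n] {k k' : ℤ}
    (h : (k : ZMod n) = k') : φ ((k : ℚ) / n) = φ ((k' : ℚ) / n) := by
  obtain ⟨c, hc⟩ := (ZMod.intCast_eq_intCast_iff_dvd_sub k k' n).mp h
  have hn : (n : ℚ) ≠ 0 := by exact_mod_cast (NeZero.ne n)
  have hk' : (k' : ℚ) = k + n * c := by
    have := congrArg (fun z : ℤ => (z : ℚ)) hc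
    push_cast at this
    linarith
  have : (k' : ℚ) / n = (k : ℚ) / n + (c : ℤ) := by
    rw [hk']
    field_simp
  rw [this, apply_add_intCast hper]

/-- The value `φ(x̃/n)` at the canonical lift `x̃ = x.val` of `x = k mod n` is `φ(k/n)`. [folklore] -/
theorem apply_val_div_eq (hper : ∀ x, φ (x + 1) = φ x) (n : ℕ) [NeZero n] {x : ZMod n} {k : ℕ}
    (h : (k : ZMod n) = x) : φ ((x.val : ℚ) / n) = φ ((k : ℚ) / n) := by
  have h' : ((x.val : ℤ) : ZMod n) = ((k : ℤ) : ZMod n) := by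
    rw [Int.cast_natCast, Int.cast_natCast, ZMod.natCast_zmod_val, h]
  have := apply_div_eq_of_intCast_eq hper h'
  push_cast at this
  exact this

/-- An `ℓ`-periodic function on `ℕ` is constant on residue classes mod `ℓ`. [folklore] -/
theorem chi_eq_of_modEq {ℓ : ℕ} (hχ : ∀ a, χ ℓ (a + ℓ) = χ ℓ a) {a b : ℕ} (h : a ≡ b [MOD ℓ]) :
    χ ℓ a = χ ℓ b := by
  have hmul : ∀ c m : ℕ, χ ℓ (c + ℓ * m) = χ ℓ c := by
    intro c m
    induction m with
    | zero => simp
    | succ m ih => rw [Nat.mul_succ, ← add_assoc, hχ, ih]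
  have ha : χ ℓ a = χ ℓ (a % ℓ) := by
    conv_lhs => rw [← Nat.mod_add_div a ℓ]
    exact hmul _ _
  have hb : χ ℓ b = χ ℓ (b % ℓ) := by
    conv_lhs => rw [← Nat.mod_add_div b ℓ]
    exact hmul _ _
  rw [ha, hb, h]

variable [CommRing R]

/-- … hence on residue classes mod any multiple `N` of `ℓ`, uniformly over a set `T` of such `ℓ`. [folklore] -/
theorem prod_chi_eq_of_modEq {N : ℕ} (T : Finset ℕ) (hχ : ∀ ℓ ∈ T, ∀ a, χ ℓ (a + ℓ) = χ ℓ a)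
    (hT : ∀ ℓ ∈ T, ℓ ∣ N) {a b : ℕ} (h : a ≡ b [MOD N]) :
    ∏ ℓ ∈ T, χ ℓ a = ∏ ℓ ∈ T, χ ℓ b :=
  Finset.prod_congr rfl fun ℓ hℓ => chi_eq_of_modEq (hχ ℓ hℓ) (h.of_dvd (hT ℓ hℓ))

/-- **The weights are additive characters**: for `a, b` prime to every `ℓ ∈ T`,
`∏_{ℓ∈T} χ_ℓ(ab) = ∑_{U ⊆ T} (∏_{ℓ∈U} χ_ℓ(b)) · ∏_{ℓ∈T∖U} χ_ℓ(a)`. [folklore] -/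
theorem prod_chi_mul (T : Finset ℕ)
    (hlog : ∀ ℓ ∈ T, ∀ a b : ℕ, a.Coprime ℓ → b.Coprime ℓ → χ ℓ (a * b) = χ ℓ a + χ ℓ b)
    {a b : ℕ} (ha : ∀ ℓ ∈ T, a.Coprime ℓ) (hb : ∀ ℓ ∈ T, b.Coprime ℓ) :
    ∏ ℓ ∈ T, χ ℓ (a * b) = ∑ U ∈ T.powerset, (∏ ℓ ∈ U, χ ℓ b) * ∏ ℓ ∈ T \ U, χ ℓ a := by
  have h : ∀ ℓ ∈ T, χ ℓ (a * b) = χ ℓ b + χ ℓ a := fun ℓ hℓ => by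
    rw [hlog ℓ hℓ a b (ha ℓ hℓ) (hb ℓ hℓ), add_comm]
  rw [Finset.prod_congr rfl h, Finset.prod_add]

/-- A unit mod `N` has canonical lift prime to every divisor `ℓ` of `N`. [folklore] -/
theorem val_coprime_of_dvd {N ℓ : ℕ} (hℓ : ℓ ∣ N) (u : (ZMod N)ˣ) : (u : ZMod N).val.Coprime ℓ :=
  Nat.Coprime.coprime_dvd_right hℓ (ZMod.val_coe_unit_coprime u)

/-- `(u c)~ ≡ ũ c̃ (mod N)` for the canonical lifts. [folklore] -/
theorem val_mul_modEq {N : ℕ} (u c : ZMod N) : (u * c).val ≡ u.val * c.val [MOD N] := by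
  rw [ZMod.val_mul]
  exact Nat.mod_modEq _ _

/-! ### §1.2 Twisted sums expand into partial sums -/

/-- **Twisted sums**: for a unit `u` mod `N` and `T` a set of divisors of `N` carrying periodic additive
characters, `∑_c φ(c̃/N) ∏_{ℓ∈T} χ_ℓ((uc)~) = ∑_{U ⊆ T} (∏_{ℓ∈T∖U} χ_ℓ(ũ)) · S_U(N)` where
`S_U(N) = ∑_c φ(c̃/N) ∏_{ℓ∈U} χ_ℓ(c̃)` is the partial Kurihara sum. [cite: Ota2018, Prop. 3.3] -/
theorem sum_mul_prod_chi_mul (N : ℕ) [NeZero N] (T : Finset ℕ)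
    (hχ : ∀ ℓ ∈ T, ∀ a, χ ℓ (a + ℓ) = χ ℓ a)
    (hlog : ∀ ℓ ∈ T, ∀ a b : ℕ, a.Coprime ℓ → b.Coprime ℓ → χ ℓ (a * b) = χ ℓ a + χ ℓ b)
    (hT : ∀ ℓ ∈ T, ℓ ∣ N) (u : (ZMod N)ˣ) :
    ∑ c : (ZMod N)ˣ, φ (((c : ZMod N).val : ℚ) / N) * ∏ ℓ ∈ T, χ ℓ ((u * c : (ZMod N)ˣ) : ZMod N).val =
      ∑ U ∈ T.powerset, (∏ ℓ ∈ T \ U, χ ℓ (u : ZMod N).val) *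
        ∑ c : (ZMod N)ˣ, φ (((c : ZMod N).val : ℚ) / N) * ∏ ℓ ∈ U, χ ℓ (c : ZMod N).val := by
  have hw : ∀ c : (ZMod N)ˣ, ∏ ℓ ∈ T, χ ℓ ((u * c : (ZMod N)ˣ) : ZMod N).val =
      ∑ U ∈ T.powerset, (∏ ℓ ∈ U, χ ℓ (c : ZMod N).val) * ∏ ℓ ∈ T \ U, χ ℓ (u : ZMod N).val := by
    intro c
    rw [Units.val_mul, prod_chi_eq_of_modEq T hχ hT (val_mul_modEq _ _)]
    exact prod_chi_mul T hlog (fun ℓ hℓ => val_coprime_of_dvd (hT ℓ hℓ) u)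
      (fun ℓ hℓ => val_coprime_of_dvd (hT ℓ hℓ) c)
  simp_rw [hw, Finset.mul_sum]
  rw [Finset.sum_comm]
  refine Finset.sum_congr rfl fun U _ => Finset.sum_congr rfl fun c _ => ?_
  ring

/-- … so when all the PROPER partial sums `S_U(N)`, `U ⊊ T`, vanish, the twisted sum is `S_T(N)` itself.
[cite: Ota2018, Prop. 3.3] -/
theorem sum_mul_prod_chi_mul_of_forall_ssubset (N : ℕ) [NeZero N] (T : Finset ℕ)
    (hχ : ∀ ℓ ∈ T, ∀ a, χ ℓ (a + ℓ) = χ ℓ a)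
    (hlog : ∀ ℓ ∈ T, ∀ a b : ℕ, a.Coprime ℓ → b.Coprime ℓ → χ ℓ (a * b) = χ ℓ a + χ ℓ b)
    (hT : ∀ ℓ ∈ T, ℓ ∣ N) (u : (ZMod N)ˣ)
    (hvan : ∀ U, U ⊂ T →
      ∑ c : (ZMod N)ˣ, φ (((c : ZMod N).val : ℚ) / N) * ∏ ℓ ∈ U, χ ℓ (c : ZMod N).val = 0) :
    ∑ c : (ZMod N)ˣ, φ (((c : ZMod N).val : ℚ) / N) * ∏ ℓ ∈ T, χ ℓ ((u * c : (ZMod N)ˣ) : ZMod N).val =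
      ∑ c : (ZMod N)ˣ, φ (((c : ZMod N).val : ℚ) / N) * ∏ ℓ ∈ T, χ ℓ (c : ZMod N).val := by
  rw [sum_mul_prod_chi_mul N T hχ hlog hT u,
    ← Finset.sum_erase_add _ _ (Finset.mem_powerset_self T), Finset.sdiff_self, Finset.prod_empty,
    one_mul, Finset.sum_eq_zero, zero_add]
  intro U hU
  rw [Finset.mem_erase, Finset.mem_powerset] at hU
  rw [hvan U (lt_of_le_of_ne hU.2 hU.1), mul_zero]

/-! ### §1.3 One prime at a time: the fibres of `ℤ/Nℓ → ℤ/N` (CRT) and the Hecke relation -/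

/-- Units of the field `ℤ/ℓ`: `∑_{c ∈ (ℤ/ℓ)ˣ} g(c) = ∑_{x ∈ ℤ/ℓ} g(x) − g(0)`. [folklore] -/
theorem sum_units_zmod_prime {ℓ : ℕ} [Fact ℓ.Prime] (g : ZMod ℓ → R) :
    ∑ c : (ZMod ℓ)ˣ, g c = (∑ x : ZMod ℓ, g x) - g 0 := by
  rw [Fintype.sum_eq_add_sum_compl (0 : ZMod ℓ) g]
  have h : ∑ x ∈ ({0}ᶜ : Finset (ZMod ℓ)), g x = ∑ c : (ZMod ℓ)ˣ, g c := by
    rw [Finset.sum_subtype (p := fun x : ZMod ℓ => x ≠ 0) ({0}ᶜ : Finset (ZMod ℓ)) (by simp),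
      ← Equiv.sum_comp unitsEquivNeZero (fun a => g a.1)]
    rfl
  rw [h]
  ring

/-- Reindexing a sum over `ℤ/ℓ` by the canonical representatives `0 ≤ x.val < ℓ`. [folklore] -/
theorem sum_zmod_val_eq_sum_fin {ℓ : ℕ} [NeZero ℓ] {M : Type*} [AddCommMonoid M] (g : ℕ → M) :
    ∑ x : ZMod ℓ, g x.val = ∑ j : Fin ℓ, g j := by
  obtain ⟨k, hk⟩ := Nat.exists_eq_succ_of_ne_zero (NeZero.ne ℓ)
  subst hk
  rfl

/-- The two CRT components of a class are its reductions: `(CRT z).1 = z mod N`, `(CRT z).2 = z mod ℓ`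
(ring homomorphisms out of `ℤ/Nℓ` are unique). [folklore] -/
theorem chineseRemainder_apply_fst {N ℓ : ℕ} (h : N.Coprime ℓ) (z : ZMod (N * ℓ)) :
    ((ZMod.chineseRemainder h) z).1 = ZMod.castHom (dvd_mul_right N ℓ) (ZMod N) z :=
  RingHom.congr_fun (RingHom.ext_zmod ((RingHom.fst (ZMod N) (ZMod ℓ)).comp
    (ZMod.chineseRemainder h : ZMod (N * ℓ) →+* ZMod N × ZMod ℓ))
    (ZMod.castHom (dvd_mul_right N ℓ) (ZMod N))) z

/-- (second component) [folklore] -/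
theorem chineseRemainder_apply_snd {N ℓ : ℕ} (h : N.Coprime ℓ) (z : ZMod (N * ℓ)) :
    ((ZMod.chineseRemainder h) z).2 = ZMod.castHom (dvd_mul_left ℓ N) (ZMod ℓ) z :=
  RingHom.congr_fun (RingHom.ext_zmod ((RingHom.snd (ZMod N) (ZMod ℓ)).comp
    (ZMod.chineseRemainder h : ZMod (N * ℓ) →+* ZMod N × ZMod ℓ))
    (ZMod.castHom (dvd_mul_left ℓ N) (ZMod ℓ))) z

/-- **The CRT lift of `(b, B + N x)` is `B + N x̃`** (`B = b.val`): for `N` prime to `ℓ`, the element of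
`ℤ/Nℓ` with residues `b mod N` and `B + N·x mod ℓ` is the class of the natural number `B + N·x.val`. [folklore] -/
theorem chineseRemainder_symm_apply_affine {N ℓ : ℕ} [NeZero N] [NeZero ℓ] (h : N.Coprime ℓ)
    (b : ZMod N) (x : ZMod ℓ) :
    (ZMod.chineseRemainder h).symm (b, (b.val : ZMod ℓ) + (N : ZMod ℓ) * x) =
      ((b.val + N * x.val : ℕ) : ZMod (N * ℓ)) := by
  apply (ZMod.chineseRemainder h).injective
  rw [RingEquiv.apply_symm_apply]
  ext
  · rw [chineseRemainder_apply_fst, map_natCast]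
    push_cast
    rw [ZMod.natCast_zmod_val, ZMod.natCast_self, zero_mul, add_zero]
  · rw [chineseRemainder_apply_snd, map_natCast]
    push_cast
    rw [ZMod.natCast_zmod_val]

/-- The first CRT component of a class is the class of its canonical lift: `(CRT z).1 = z̃ mod N`. [folklore] -/
theorem chineseRemainder_fst_eq_natCast_val {N ℓ : ℕ} [NeZero N] [NeZero ℓ] (h : N.Coprime ℓ)
    (z : ZMod (N * ℓ)) : ((ZMod.chineseRemainder h) z).1 = (z.val : ZMod N) := by
  rw [chineseRemainder_apply_fst, ZMod.castHom_apply, ZMod.cast_eq_val]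

/-- **The full fibre and the Hecke relation**: for `N` prime to the prime `ℓ` and `b ∈ ℤ/N` (`B = b.val`),
`∑_{x ∈ ℤ/ℓ} φ(CRT⁻¹(b, x)~ / Nℓ) = ∑_{j<ℓ} φ((B + N j)/(Nℓ)) = 2 φ(B/N) − φ(ℓ B/N)` — the `ℓ`
classes over `b` are `B + N j`, `j < ℓ`, and `(B + N j)/(N ℓ) = (B/N + j)/ℓ`.
[cite: MazurTateTeitelbaum1986Invent, §I.4 (4.2)] -/
theorem sum_fiber_eq_of_hecke {N ℓ : ℕ} [NeZero N] [Fact ℓ.Prime] (h : N.Coprime ℓ)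
    (hper : ∀ x, φ (x + 1) = φ x)
    (hH : ∀ x : ℚ, 2 * φ x = (∑ j : Fin ℓ, φ ((x + j) / ℓ)) + φ (ℓ * x)) (b : ZMod N) :
    ∑ x : ZMod ℓ, φ ((((ZMod.chineseRemainder h).symm (b, x)).val : ℚ) / (N * ℓ : ℕ)) =
      2 * φ ((b.val : ℚ) / N) - φ ((ℓ * b.val : ℕ) / N) := by
  have hℓ : ℓ.Prime := Fact.out
  have hN0 : (N : ℚ) ≠ 0 := by exact_mod_cast (NeZero.ne N)
  have hℓ0 : (ℓ : ℚ) ≠ 0 := by exact_mod_cast hℓ.ne_zero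
  -- the affine bijection `x ↦ B + N x` of `ℤ/ℓ` (`N` is a unit mod `ℓ`)
  have hNu : (N : ZMod ℓ) ≠ 0 := by
    rw [ne_eq, ZMod.natCast_eq_zero_iff]
    intro hd
    exact hℓ.one_lt.ne' (Nat.Coprime.eq_one_of_dvd h.symm hd)
  have hbij : Function.Bijective fun x : ZMod ℓ => (b.val : ZMod ℓ) + (N : ZMod ℓ) * x :=
    ((Equiv.mulLeft₀ (N : ZMod ℓ) hNu).trans (Equiv.addLeft (b.val : ZMod ℓ))).bijective
  rw [← hbij.sum_comp (fun x : ZMod ℓ =>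
    φ ((((ZMod.chineseRemainder h).symm (b, x)).val : ℚ) / (N * ℓ : ℕ)))]
  simp only [chineseRemainder_symm_apply_affine h]
  have hval : ∀ x : ZMod ℓ, φ (((((b.val + N * x.val : ℕ) : ZMod (N * ℓ))).val : ℚ) / (N * ℓ : ℕ)) =
      φ (((b.val + N * x.val : ℕ) : ℚ) / (N * ℓ : ℕ)) := fun x => apply_val_div_eq hper _ rfl
  simp only [hval]
  rw [sum_zmod_val_eq_sum_fin (fun j : ℕ => φ (((b.val + N * j : ℕ) : ℚ) / (N * ℓ : ℕ)))]
  have hj : ∀ j : Fin ℓ, φ (((b.val + N * (j : ℕ) : ℕ) : ℚ) / (N * ℓ : ℕ)) =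
      φ ((((b.val : ℚ) / N) + (j : ℕ)) / ℓ) := fun j => by
    congr 1
    push_cast
    field_simp
  simp only [hj]
  have hH' := hH ((b.val : ℚ) / N)
  rw [show (ℓ : ℚ) * ((b.val : ℚ) / N) = ((ℓ * b.val : ℕ) : ℚ) / N by push_cast; ring] at hH'
  have hsum : (∑ j : Fin ℓ, φ ((((b.val : ℚ) / N) + ((j : ℕ) : ℚ)) / ℓ)) =
      ∑ j : Fin ℓ, φ ((((b.val : ℚ) / N) + (j : ℚ)) / ℓ) :=
    Finset.sum_congr rfl fun j _ => by norm_cast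
  rw [hsum]
  linear_combination -hH'

omit [CommRing R] in
/-- **The missing class**: the one class over a unit `b` mod `N` that is `0 mod ℓ` contributes
`φ(CRT⁻¹(b,0)~/Nℓ) = φ((ℓ⁻¹ b)~/N)`. [folklore] -/
theorem apply_fiber_zero {N ℓ : ℕ} [NeZero N] [Fact ℓ.Prime] (h : N.Coprime ℓ)
    (hper : ∀ x, φ (x + 1) = φ x) (b : ZMod N) :
    φ ((((ZMod.chineseRemainder h).symm (b, 0)).val : ℚ) / (N * ℓ : ℕ)) =
      φ (((((ZMod.unitOfCoprime ℓ h.symm)⁻¹ : (ZMod N)ˣ) : ZMod N) * b).val / N) := by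
  have hℓ : ℓ.Prime := Fact.out
  have hN0 : (N : ℚ) ≠ 0 := by exact_mod_cast (NeZero.ne N)
  have hℓ0 : (ℓ : ℚ) ≠ 0 := by exact_mod_cast hℓ.ne_zero
  have hNu : (N : ZMod ℓ) ≠ 0 := by
    rw [ne_eq, ZMod.natCast_eq_zero_iff]
    intro hd
    exact hℓ.one_lt.ne' (Nat.Coprime.eq_one_of_dvd h.symm hd)
  -- the class `x₀` with `B + N x₀ = 0 mod ℓ`
  obtain ⟨x₀, hx₀⟩ := ((Equiv.mulLeft₀ (N : ZMod ℓ) hNu).trans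
    (Equiv.addLeft (b.val : ZMod ℓ))).surjective 0
  change (b.val : ZMod ℓ) + (N : ZMod ℓ) * x₀ = 0 at hx₀
  rw [← hx₀, chineseRemainder_symm_apply_affine h, apply_val_div_eq hper _ rfl]
  -- `ℓ ∣ B + N x₀`
  have hdvd : ℓ ∣ b.val + N * x₀.val := by
    rw [← ZMod.natCast_eq_zero_iff, ← hx₀]
    push_cast
    rw [ZMod.natCast_zmod_val]
  obtain ⟨t, ht⟩ := hdvd
  have hq : (((b.val + N * x₀.val : ℕ) : ℚ) / (N * ℓ : ℕ)) = (t : ℚ) / N := by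
    rw [ht]
    push_cast
    field_simp
  rw [hq]
  -- `t ≡ ℓ⁻¹ b (mod N)`
  refine (apply_val_div_eq hper N ?_).symm
  have hℓt : ((ℓ : ZMod N)) * (t : ZMod N) = b := by
    have := congrArg (fun m : ℕ => (m : ZMod N)) ht
    push_cast at this
    rw [ZMod.natCast_zmod_val, ZMod.natCast_self, zero_mul, add_zero] at this
    exact this.symm
  rw [← hℓt, ← ZMod.coe_unitOfCoprime ℓ h.symm, ← mul_assoc, Units.inv_mul, one_mul]

end Abstract

end Summit.BirchSwinnertonDyer.BirchSwinnertonDyer.Theorems.KimAtThreeDeepLowerLevelLoweringFibers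

end
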